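import Summits.HodgeConjecture.HodgeConjecture.Theorems.F0P3cStCharTSTorusChartIso   -- ★ p849564∕«CHART-ISO★» (LH6-p01): the N = 3 TERMS OF RECORD (`torusChart`, `vanDijkWeight`, `hyperbolicSet`, `torusChartEquiv`) ported here 3 ↦ 2; brings ★ `continuous_torusEntry`, ★ `HeisRing.skewModulus`, ★ `rootDeltaChar`
import Literature.NumberTheory.Automorphic.UnitaryGroupBorelInduction                  -- ★ `cmBorelTriple`, `cmLocalForm_eq_over`, `torusU`, `torusEntry`, `glDiagonal_mem_unitaryGroupOfForm_antidiagonal_iff`, `conjLocal_conjLocal_cm`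
import HarnessLib

/-!
# K2_E3 road (h413), PART «RANK» (qs2-ps) «van Dijk₂» — (TOR₂-Defs): THE TERMS OF RECORD OF THE QUASI-SPLIT `U(1,1)` PRINCIPAL-SERIES ROAD AT `N = 2`:
# torus chart `ι₂`, van Dijk weight `Δ₂`, regular hyperbolic set `Ω₂`, Weyl discriminant `dg₂`  [Rogawski1990, §12.2 p. 173; §4.9 (4.9.4) p. 56; §12.5 p. 182]

Cell `pub/hodgecm-mathlib` (D-0151), Track B, crux H413 = `stmt-HodgeConjecture-24833` (`--supports` lane, `--kind definition`, reviewed), route HCCMUnconditional; seat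
K2E3-p26 (g0), deal D115 (dealer K2E3-plan (g4) 2026-09-04T13:33:49Z; cut (qs2-ps) of K2E3-p21 (g7) 13:26:08Z; architect K2E3-p25 (g2)).  DEF LANE (precedent ★
`Theorems/F0P3cStCharTSTorusDefs` + ★ `…TorusChartIso` at `N = 3`, LH6-p01): eight `def`s + their `rfl`-grade unfolding lemmas + the topological-group packaging; NO instance,
NO notation, NO `sorry`, NO named fact; nothing is asserted about `U(1,1)` beyond bookkeeping.  Every brick of the (qs2-ps) road reads these names: (VDW₂) D116 K2E3-p11 (g7),
(HCD₂) D117 K2E3-p27 (g0), (WEYL₂) D118 K2E3-p14 (g7), (CLS₂-fun) D119 K2E3-p25 (g2), (ASM₂) K2E3-p21 lineage.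
CURRENCY: `G₂ = ↥(unitaryGroupOfForm (conjLocal L c v) (cmLocalForm L 2 v))` (= `U(Φ₂)(L⁺_v)`, `Φ₂` antidiagonal), `T₂ = (cmBorelTriple L 2 v).M` its diagonal torus
`{d(α, σ(α)⁻¹)}`, PARAMETER torus `(LocalRing L v)ˣ = (Π_{w∣v} L_w)ˣ` (`= E_wˣ` at a non-split `v`), `σ = conjLocal L c v` (an involution, ★ `conjLocal_conjLocal_cm`).
* `torusChart₂ L v : (LocalRing L v)ˣ → T₂`, `α ↦ d(α, σ(α)⁻¹)` (§12.2 p. 173 at rank one: `M ≅ E*`); inverse `torusCoords₂ = torusEntry 0`; packaged as the topological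
  group isomorphism **`torusChartEquiv₂ : (LocalRing L v)ˣ ≃ₜ* T₂`** (= `ι₂`).
* **`vanDijkWeight₂ L v : T₂ → ℂ`** (= `Δ₂`), print's `Δ(m) = |D_G(m)|`-type weight in the normalisation of the `N = 3` term of record ★ `vanDijkWeight` with the
  Heisenberg-vector factor dropped: for `t` REGULAR in the sense «`d₀⁻¹d₁ − 1` is a unit» (`d i = torusEntry i t`) it is `δ_{B₂}^{1∕2}(t) · χ⁻(d₀⁻¹d₁ − 1)`, where `χ⁻`
  is the modulus of the σ-fixed unit `d₀⁻¹d₁ − 1 = (d₀ σ(d₀))⁻¹ − 1` acting on the SKEW line `{x : σx = −x} = Lie N₂` (★ `HeisRing.skewModulus`; `Ad(t⁻¹) − 1` on `𝔫₂`),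
  and `0` otherwise.
* **`hyperbolicSet₂ L v : Set G₂`** (= `Ω₂`), the conjugates of the regular elements of `T₂` (§12.5 p. 182).
* **`dgFormula₂ L v : G₂ → ℝ`** (= `dg₂`), `D_G(γ) = |Π_{α ∈ Φ}(1 − α(γ))|_{L⁺_v}^{1∕2} = ⁴√( N(discr(charpoly γ)) · N(det γ)^{-(N−1)} )` at `N = 2`, `N(x) = Π_{w∣v} |x_w|_w`
  (★ DG-FIELD convention of `F0P3cStCharTSDGField`, there spelled inline at `N = 3` with det-exponent `2`): the Weyl denominator for which «`dg₂⁻¹ ∈ L¹_loc`» (HCD₂) holds.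
HONEST LABEL: HC_CM is proved only modulo the 7 printed citations (2 remaining named inputs: hLiu418 = stmt-HodgeConjecture-24832, h413 = stmt-HodgeConjecture-24833) until rung 0
closes; count-neutral (definitions only).

## References
* [Rogawski1990] J. D. Rogawski, *Automorphic Representations of Unitary Groups in Three Variables*, Ann. of Math. Stud. 123 (1990): §1.10 p. 9; §12.2 p. 173; §12.5 pp. 182–183;
  §12.7 L. 12.7.2 (proof) p. 193; §4.9 (4.9.4) p. 56, p. 54 (`D_G`).
* [vanDijk1972] G. van Dijk, *Computation of certain induced characters of 𝔭-adic groups*, Math. Ann. 199 (1972), Thm. p. 237.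
* [HarishChandra1999AdmissibleDistributions] Harish-Chandra (DeBacker–Sally), *Admissible invariant distributions on reductive p-adic groups* (1999), §17 (`D_G`).
-/

set_option autoImplicit false
-- the mandated namespace has the single-problem summit's repeated segment (`HodgeConjecture.HodgeConjecture`)
set_option linter.dupNamespace false

noncomputable section

open NumberField IsDedekindDomain MeasureTheory Topology
open scoped Matrix MatrixGroups NNReal
open Literature.NumberTheory.Rogawski1990 Literature.NumberTheory.Automorphic Literature.NumberTheory.Automorphic.UnitaryGroup
open Literature.NumberTheory.GaloisRepresentations Literature.NumberTheory.GaloisRepresentations.IsNonarchimedeanLocalField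
open Literature.MeasureTheory.Group

namespace Summit.HodgeConjecture.HodgeConjecture.Cruxes.H413.K2E3QuasiSplitTwoTorusDefs

variable (L : Type) [Field L] [NumberField L] [IsCMField L] (v : HeightOneSpectrum (𝓞 ↥(maximalRealSubfield L)))

/-! ## §1 The torus chart `ι₂ : E_vˣ → T₂`, `α ↦ d(α, σ(α)⁻¹)` -/

/-- The diagonal entries of the chart: `(α, σ(α)⁻¹)`. [cite: Rogawski1990, §12.2 p. 173; §1.10 p. 9] -/
def torusChartEntries₂ (a : (LocalRing L v)ˣ) : Fin 2 → (LocalRing L v)ˣ :=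
  ![a, (Units.map ((conjLocal L (IsCMField.complexConj L) v : LocalRing L v →+* LocalRing L v) : LocalRing L v →* LocalRing L v) a)⁻¹]

/-- Unfolding, first entry: `α`. [cite: Rogawski1990, §12.2 p. 173] -/
@[simp] theorem torusChartEntries₂_zero (a : (LocalRing L v)ˣ) : torusChartEntries₂ L v a 0 = a := rfl

/-- Unfolding, second entry: `σ(α)⁻¹`. [cite: Rogawski1990, §12.2 p. 173] -/
@[simp] theorem torusChartEntries₂_one (a : (LocalRing L v)ˣ) :
    torusChartEntries₂ L v a 1 = (Units.map ((conjLocal L (IsCMField.complexConj L) v : LocalRing L v →+* LocalRing L v) : LocalRing L v →* LocalRing L v) a)⁻¹ := rfl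

/-- `d(α, σ(α)⁻¹) ∈ U(Φ₂)(L⁺_v)`: the two relations `σ(d_{1−i}) d_i = 1` of ★ `glDiagonal_mem_unitaryGroupOfForm_antidiagonal_iff` (`σ` is an involution).
[cite: Rogawski1990, §1.10 p. 9; §12.2 p. 173] -/
theorem glDiagonal_torusChartEntries₂_mem (a : (LocalRing L v)ˣ) :
    glDiagonal 2 (LocalRing L v) (torusChartEntries₂ L v a) ∈ unitaryGroupOfForm (conjLocal L (IsCMField.complexConj L) v) (cmLocalForm L 2 v) := by
  rw [cmLocalForm_eq_over L 2 v, glDiagonal_mem_unitaryGroupOfForm_antidiagonal_iff]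
  set σu : (LocalRing L v)ˣ →* (LocalRing L v)ˣ :=
    Units.map ((conjLocal L (IsCMField.complexConj L) v : LocalRing L v →+* LocalRing L v) : LocalRing L v →* LocalRing L v) with hσu
  have hcoe : ∀ u : (LocalRing L v)ˣ, conjLocal L (IsCMField.complexConj L) v (u : LocalRing L v) = ((σu u : (LocalRing L v)ˣ) : LocalRing L v) :=
    fun u => by rw [hσu, Units.coe_map, MonoidHom.coe_coe]
  have hσσ : ∀ u : (LocalRing L v)ˣ, σu (σu u) = u := fun u => by
    apply Units.ext
    rw [hσu, Units.coe_map, Units.coe_map, MonoidHom.coe_coe, conjLocal_conjLocal_cm L v]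
  have h0 : torusChartEntries₂ L v a 0 = a := rfl
  have h1 : torusChartEntries₂ L v a 1 = (σu a)⁻¹ := rfl
  intro i
  fin_cases i
  · -- `i = 0`: `σ(d₁) d₀ = σ(σ(α)⁻¹) α = α⁻¹ α = 1`
    show conjLocal L (IsCMField.complexConj L) v ((torusChartEntries₂ L v a (Fin.rev 0) : (LocalRing L v)ˣ) : LocalRing L v) *
      ((torusChartEntries₂ L v a 0 : (LocalRing L v)ˣ) : LocalRing L v) = 1
    have hrev : (Fin.rev 0 : Fin 2) = 1 := by decide
    rw [hrev, h1, h0, hcoe, ← Units.val_mul, map_inv, hσσ, inv_mul_cancel, Units.val_one]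
  · -- `i = 1`: `σ(d₀) d₁ = σ(α) σ(α)⁻¹ = 1`
    show conjLocal L (IsCMField.complexConj L) v ((torusChartEntries₂ L v a (Fin.rev 1) : (LocalRing L v)ˣ) : LocalRing L v) *
      ((torusChartEntries₂ L v a 1 : (LocalRing L v)ˣ) : LocalRing L v) = 1
    have hrev : (Fin.rev 1 : Fin 2) = 0 := by decide
    rw [hrev, h0, h1, hcoe, ← Units.val_mul, mul_inv_cancel, Units.val_one]

/-- **THE TORUS CHART `ι₂ : E_vˣ → T₂`**, `α ↦ d(α, σ(α)⁻¹)` — print's rank-one torus `M ≅ E*`. [cite: Rogawski1990, §12.2 p. 173] -/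
def torusChart₂ (a : (LocalRing L v)ˣ) : ↥(cmBorelTriple L 2 v).M :=
  ⟨⟨glDiagonal 2 (LocalRing L v) (torusChartEntries₂ L v a), glDiagonal_torusChartEntries₂_mem L v a⟩, (mem_torusU_iff _).2 ⟨torusChartEntries₂ L v a, rfl⟩⟩

/-- Unfolding: the underlying invertible matrix of `ι₂ α` is `diag(α, σ(α)⁻¹)`. [cite: Rogawski1990, §12.2 p. 173] -/
@[simp] theorem coe_torusChart₂ (a : (LocalRing L v)ˣ) :
    (((torusChart₂ L v a : ↥(cmBorelTriple L 2 v).M) : ↥(unitaryGroupOfForm (conjLocal L (IsCMField.complexConj L) v) (cmLocalForm L 2 v))) :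
      GL (Fin 2) (LocalRing L v)) = glDiagonal 2 (LocalRing L v) (torusChartEntries₂ L v a) := rfl

/-- The entries of `ι₂ α` are `torusChartEntries₂ α`. [cite: Rogawski1990, §12.2 p. 173] -/
theorem torusEntry_torusChart₂ (a : (LocalRing L v)ˣ) (i : Fin 2) :
    torusEntry (conjLocal L (IsCMField.complexConj L) v) (cmLocalForm L 2 v) i (torusChart₂ L v a) = torusChartEntries₂ L v a i :=
  torusEntry_eq_of_glDiagonal_eq _ _ i _ _ rfl

/-- First coordinate: `torusEntry 0 (ι₂ α) = α`. [cite: Rogawski1990, §12.2 p. 173] -/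
@[simp] theorem torusEntry_zero_torusChart₂ (a : (LocalRing L v)ˣ) :
    torusEntry (conjLocal L (IsCMField.complexConj L) v) (cmLocalForm L 2 v) 0 (torusChart₂ L v a) = a := by
  rw [torusEntry_torusChart₂]; rfl

/-- Second coordinate: `torusEntry 1 (ι₂ α) = σ(α)⁻¹`. [cite: Rogawski1990, §12.2 p. 173] -/
theorem torusEntry_one_torusChart₂ (a : (LocalRing L v)ˣ) :
    torusEntry (conjLocal L (IsCMField.complexConj L) v) (cmLocalForm L 2 v) 1 (torusChart₂ L v a) =
      (Units.map ((conjLocal L (IsCMField.complexConj L) v : LocalRing L v →+* LocalRing L v) : LocalRing L v →* LocalRing L v) a)⁻¹ := by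
  rw [torusEntry_torusChart₂]; rfl

/-- The chart entries are MULTIPLICATIVE in `α` (everything commutes in `E_vˣ`). [cite: Rogawski1990, §12.2 p. 173] -/
theorem torusChartEntries₂_mul (a a' : (LocalRing L v)ˣ) : torusChartEntries₂ L v (a * a') = torusChartEntries₂ L v a * torusChartEntries₂ L v a' := by
  funext i
  fin_cases i
  · rfl
  · show (Units.map ((conjLocal L (IsCMField.complexConj L) v : LocalRing L v →+* LocalRing L v) : LocalRing L v →* LocalRing L v) (a * a'))⁻¹ =
      (Units.map ((conjLocal L (IsCMField.complexConj L) v : LocalRing L v →+* LocalRing L v) : LocalRing L v →* LocalRing L v) a)⁻¹ *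
      (Units.map ((conjLocal L (IsCMField.complexConj L) v : LocalRing L v →+* LocalRing L v) : LocalRing L v →* LocalRing L v) a')⁻¹
    rw [map_mul, mul_inv]

/-- At `1` the chart entries are `1`. [cite: Rogawski1990, §12.2 p. 173] -/
theorem torusChartEntries₂_map_one : torusChartEntries₂ L v 1 = 1 := by
  funext i
  fin_cases i
  · rfl
  · show (Units.map ((conjLocal L (IsCMField.complexConj L) v : LocalRing L v →+* LocalRing L v) : LocalRing L v →* LocalRing L v) 1)⁻¹ = 1
    rw [map_one, inv_one]

/-- **The chart is a group homomorphism `E_vˣ →* T₂`** (hom form of `torusChart₂`, same function). [cite: Rogawski1990, §12.2 p. 173] -/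
def torusChartHom₂ : (LocalRing L v)ˣ →* ↥(cmBorelTriple L 2 v).M where
  toFun := torusChart₂ L v
  map_one' := by
    apply Subtype.ext; apply Subtype.ext
    show glDiagonal 2 (LocalRing L v) (torusChartEntries₂ L v 1) = 1
    rw [torusChartEntries₂_map_one, map_one]
  map_mul' a a' := by
    apply Subtype.ext; apply Subtype.ext
    show glDiagonal 2 (LocalRing L v) (torusChartEntries₂ L v (a * a')) =
      glDiagonal 2 (LocalRing L v) (torusChartEntries₂ L v a) * glDiagonal 2 (LocalRing L v) (torusChartEntries₂ L v a')
    rw [torusChartEntries₂_mul, map_mul]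

/-- `torusChartHom₂` IS `torusChart₂` (`rfl`). [cite: Rogawski1990, §12.2 p. 173] -/
@[simp] theorem torusChartHom₂_apply (a : (LocalRing L v)ˣ) : torusChartHom₂ L v a = torusChart₂ L v a := rfl

/-- **W-compatibility**: the chart of the reflected parameter `ω(α) = σ(α)⁻¹` has the entries of `ι₂ α` in REVERSED order — `d(σ(α)⁻¹, α)` (print's Weyl reflection
`w₀ = antidiag`). [cite: Rogawski1990, §12.2 p. 173; §12.7 L. 12.7.2 (proof) p. 193] -/
theorem torusChartEntries₂_reflect (a : (LocalRing L v)ˣ) (i : Fin 2) :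
    torusChartEntries₂ L v (Units.map ((conjLocal L (IsCMField.complexConj L) v : LocalRing L v →+* LocalRing L v) : LocalRing L v →* LocalRing L v) a)⁻¹ i =
      torusChartEntries₂ L v a (Fin.rev i) := by
  have hσσ : ∀ u : (LocalRing L v)ˣ,
      Units.map ((conjLocal L (IsCMField.complexConj L) v : LocalRing L v →+* LocalRing L v) : LocalRing L v →* LocalRing L v)
        (Units.map ((conjLocal L (IsCMField.complexConj L) v : LocalRing L v →+* LocalRing L v) : LocalRing L v →* LocalRing L v) u) = u :=
    fun u => by
      apply Units.ext
      rw [Units.coe_map, Units.coe_map, MonoidHom.coe_coe, conjLocal_conjLocal_cm L v]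
  fin_cases i
  · rfl
  · show (Units.map ((conjLocal L (IsCMField.complexConj L) v : LocalRing L v →+* LocalRing L v) : LocalRing L v →* LocalRing L v)
        (Units.map ((conjLocal L (IsCMField.complexConj L) v : LocalRing L v →+* LocalRing L v) : LocalRing L v →* LocalRing L v) a)⁻¹)⁻¹ = a
    rw [map_inv, hσσ, inv_inv]

/-! ## §2 The chart is a topological group isomorphism `ι₂ : E_vˣ ≃ₜ* T₂` -/

omit [IsCMField L] in
/-- `d ↦ diag(d) : (Fin 2 → E_vˣ) → GL₂(E_v)` is continuous. [folklore] -/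
theorem continuous_glDiagonal_two : Continuous fun d : Fin 2 → (LocalRing L v)ˣ => glDiagonal 2 (LocalRing L v) d := by
  refine Units.continuous_iff.2 ⟨?_, ?_⟩
  · refine (Continuous.matrix_diagonal (continuous_pi fun k => Units.continuous_val.comp (continuous_apply k)) :
      Continuous fun d : Fin 2 → (LocalRing L v)ˣ => Matrix.diagonal fun k => ((d k : (LocalRing L v)ˣ) : LocalRing L v)).congr fun d => ?_
    exact (coe_glDiagonal _ _ d).symm
  · refine (Continuous.matrix_diagonal (continuous_pi fun k => Units.continuous_coe_inv.comp (continuous_apply k)) :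
      Continuous fun d : Fin 2 → (LocalRing L v)ˣ => Matrix.diagonal fun k => (((d k)⁻¹ : (LocalRing L v)ˣ) : LocalRing L v)).congr fun d => ?_
    show (Matrix.diagonal fun k => (((d k)⁻¹ : (LocalRing L v)ˣ) : LocalRing L v)) = Units.val (glDiagonal 2 (LocalRing L v) d)⁻¹
    rw [← map_inv, coe_glDiagonal]
    rfl

/-- The chart entries `(α, σ(α)⁻¹)` depend continuously on `α`. [cite: Rogawski1990, §12.2 p. 173] -/
theorem continuous_torusChartEntries₂ : Continuous (torusChartEntries₂ L v) := by
  have hσ : Continuous (Units.map ((conjLocal L (IsCMField.complexConj L) v : LocalRing L v →+* LocalRing L v) : LocalRing L v →* LocalRing L v)) :=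
    Continuous.units_map _ (continuous_conjLocal L (IsCMField.complexConj L) v)
  refine continuous_pi fun i => ?_
  fin_cases i
  · exact continuous_id
  · exact hσ.inv

/-- **The torus chart `ι₂` is continuous.** [cite: Rogawski1990, §12.2 p. 173] -/
theorem continuous_torusChart₂ : Continuous (torusChart₂ L v) :=
  ((continuous_glDiagonal_two L v).comp (continuous_torusChartEntries₂ L v)).subtype_mk _ |>.subtype_mk _

/-- The inverse chart `T₂ → E_vˣ`, `t ↦ t₀₀` (★ `torusEntry 0`). [cite: Rogawski1990, §12.2 p. 173] -/
def torusCoords₂ (t : ↥(cmBorelTriple L 2 v).M) : (LocalRing L v)ˣ :=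
  torusEntry (conjLocal L (IsCMField.complexConj L) v) (cmLocalForm L 2 v) 0 t

/-- Unfolding: `torusCoords₂ t = torusEntry 0 t`. [cite: Rogawski1990, §12.2 p. 173] -/
@[simp] theorem torusCoords₂_apply (t : ↥(cmBorelTriple L 2 v).M) :
    torusCoords₂ L v t = torusEntry (conjLocal L (IsCMField.complexConj L) v) (cmLocalForm L 2 v) 0 t := rfl

/-- `coords (ι₂ α) = α`. [cite: Rogawski1990, §12.2 p. 173] -/
theorem torusCoords₂_torusChart₂ (a : (LocalRing L v)ˣ) : torusCoords₂ L v (torusChart₂ L v a) = a :=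
  torusEntry_zero_torusChart₂ L v a

/-- `ι₂ (coords t) = t`: a torus element `d(d₀, d₁)` is recovered from `d₀` through the torus relation `σ(d₀) d₁ = 1` (★ `glDiagonal_mem_unitaryGroupOfForm_antidiagonal_iff`):
`d₁ = σ(d₀)⁻¹`. [cite: Rogawski1990, §1.10 p. 9; §12.2 p. 173] -/
theorem torusChart₂_torusCoords₂ (t : ↥(cmBorelTriple L 2 v).M) : torusChart₂ L v (torusCoords₂ L v t) = t := by
  obtain ⟨d, hd⟩ := (mem_torusU_iff _).1 t.2
  set σu : (LocalRing L v)ˣ →* (LocalRing L v)ˣ :=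
    Units.map ((conjLocal L (IsCMField.complexConj L) v : LocalRing L v →+* LocalRing L v) : LocalRing L v →* LocalRing L v) with hσu
  have hmem : glDiagonal 2 (LocalRing L v) d ∈ unitaryGroupOfForm (conjLocal L (IsCMField.complexConj L) v) ((StdForm.antidiagonal 2).over (LocalRing L v)) := by
    rw [← cmLocalForm_eq_over L 2 v, hd]; exact (t : ↥(unitaryGroupOfForm (conjLocal L (IsCMField.complexConj L) v) (cmLocalForm L 2 v))).2
  have hrel := (glDiagonal_mem_unitaryGroupOfForm_antidiagonal_iff (conjLocal L (IsCMField.complexConj L) v) 2 d).1 hmem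
  have hrelu : ∀ i : Fin 2, σu (d (Fin.rev i)) * d i = 1 := fun i => by
    apply Units.ext
    rw [Units.val_mul, hσu, Units.coe_map, MonoidHom.coe_coe, Units.val_one]
    exact hrel i
  have h1 : σu (d 0) = (d 1)⁻¹ := by
    have := hrelu 1
    rw [show (Fin.rev 1 : Fin 2) = 0 from by decide] at this
    exact eq_inv_of_mul_eq_one_left this
  have hc0 : torusCoords₂ L v t = d 0 := torusEntry_eq_of_glDiagonal_eq _ _ 0 t d hd
  apply Subtype.ext; apply Subtype.ext
  rw [coe_torusChart₂, ← hd]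
  congr 1
  funext i
  fin_cases i
  · exact hc0
  · show (σu (torusCoords₂ L v t))⁻¹ = d 1
    rw [hc0, h1, inv_inv]

/-- **THE TORUS CHART AS A TOPOLOGICAL GROUP ISOMORPHISM `ι₂ : E_vˣ ≃ₜ* T₂`** (print's rank-one `M ≅ E*`): `torusChartHom₂` with its continuous inverse `t ↦ t₀₀`
(★ `continuous_torusEntry`). [cite: Rogawski1990, §12.2 p. 173] -/
def torusChartEquiv₂ : (LocalRing L v)ˣ ≃ₜ* ↥(cmBorelTriple L 2 v).M :=
  { torusChartHom₂ L v with
    invFun := torusCoords₂ L v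
    left_inv := torusCoords₂_torusChart₂ L v
    right_inv := torusChart₂_torusCoords₂ L v
    continuous_toFun := continuous_torusChart₂ L v
    continuous_invFun := continuous_torusEntry (conjLocal L (IsCMField.complexConj L) v) (cmLocalForm L 2 v) 0 }

/-- `torusChartEquiv₂` IS `torusChart₂` (`rfl`). [cite: Rogawski1990, §12.2 p. 173] -/
@[simp] theorem torusChartEquiv₂_apply (a : (LocalRing L v)ˣ) : torusChartEquiv₂ L v a = torusChart₂ L v a := rfl

/-- `⇑torusChartEquiv₂ = torusChart₂` (`rfl`). [cite: Rogawski1990, §12.2 p. 173] -/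
theorem coe_torusChartEquiv₂ : ⇑(torusChartEquiv₂ L v) = torusChart₂ L v := rfl

/-- The chart is a bijection. [cite: Rogawski1990, §12.2 p. 173] -/
theorem torusChart₂_bijective : Function.Bijective (torusChart₂ L v) := (torusChartEquiv₂ L v).bijective

/-! ## §3 van Dijk's weight `Δ₂(t)` -/

/-- `diag(torusEntry · t) = t` for `t` in the diagonal torus. [cite: Rogawski1990, §1.10 p. 9] -/
theorem glDiagonal_torusEntry_two (t : ↥(cmBorelTriple L 2 v).M) :
    glDiagonal 2 (LocalRing L v) (fun i => torusEntry (conjLocal L (IsCMField.complexConj L) v) (cmLocalForm L 2 v) i t) =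
      ((t : ↥(unitaryGroupOfForm (conjLocal L (IsCMField.complexConj L) v) (cmLocalForm L 2 v))) : GL (Fin 2) (LocalRing L v)) := by
  obtain ⟨d, hd⟩ := (mem_torusU_iff _).1 t.2
  have : (fun i => torusEntry (conjLocal L (IsCMField.complexConj L) v) (cmLocalForm L 2 v) i t) = d :=
    funext fun i => torusEntry_eq_of_glDiagonal_eq _ _ i t d hd
  rw [this, hd]

/-- **The ratio `d₀⁻¹d₁` of a torus element is σ-FIXED** (`σ(d₀) d₁ = 1`, so `d₀⁻¹ d₁ = σ(d₁) d₁`), hence so is `d₀⁻¹d₁ − 1`: the scalar by which `Ad(t⁻¹) − 1` acts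
on the skew line `Lie N₂` lies in `L⁺_v ⊗ 1`. [cite: Rogawski1990, §1.10 p. 9; §12.2 p. 173] -/
theorem map_unit_torusRatio_sub_one₂ (t : ↥(cmBorelTriple L 2 v).M)
    (h : IsUnit ((((torusEntry (conjLocal L (IsCMField.complexConj L) v) (cmLocalForm L 2 v) 0 t)⁻¹ *
      torusEntry (conjLocal L (IsCMField.complexConj L) v) (cmLocalForm L 2 v) 1 t : (LocalRing L v)ˣ) : LocalRing L v) - 1)) :
    conjLocal L (IsCMField.complexConj L) v ((h.unit : (LocalRing L v)ˣ) : LocalRing L v) = h.unit := by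
  obtain ⟨d, hd⟩ := (mem_torusU_iff _).1 t.2
  have hmem : glDiagonal 2 (LocalRing L v) d ∈ unitaryGroupOfForm (conjLocal L (IsCMField.complexConj L) v) ((StdForm.antidiagonal 2).over (LocalRing L v)) := by
    rw [← cmLocalForm_eq_over L 2 v, hd]; exact (t : ↥(unitaryGroupOfForm (conjLocal L (IsCMField.complexConj L) v) (cmLocalForm L 2 v))).2
  have hrel := (glDiagonal_mem_unitaryGroupOfForm_antidiagonal_iff (conjLocal L (IsCMField.complexConj L) v) 2 d).1 hmem
  have h10 : conjLocal L (IsCMField.complexConj L) v (d 1 : LocalRing L v) * (d 0 : LocalRing L v) = 1 := by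
    have := hrel 0; rwa [show (Fin.rev 0 : Fin 2) = 1 from by decide] at this
  have h01 : conjLocal L (IsCMField.complexConj L) v (d 0 : LocalRing L v) * (d 1 : LocalRing L v) = 1 := by
    have := hrel 1; rwa [show (Fin.rev 1 : Fin 2) = 0 from by decide] at this
  have hd0 : torusEntry (conjLocal L (IsCMField.complexConj L) v) (cmLocalForm L 2 v) 0 t = d 0 := torusEntry_eq_of_glDiagonal_eq _ _ 0 t d hd
  have hd1 : torusEntry (conjLocal L (IsCMField.complexConj L) v) (cmLocalForm L 2 v) 1 t = d 1 := torusEntry_eq_of_glDiagonal_eq _ _ 1 t d hd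
  -- `d₀⁻¹ = σ(d₁)` and `d₀⁻¹ d₁ = σ(d₁) d₁`, which `σ` (an involution of a commutative ring) fixes
  have hinv : (((d 0)⁻¹ : (LocalRing L v)ˣ) : LocalRing L v) = conjLocal L (IsCMField.complexConj L) v (d 1 : LocalRing L v) := by
    rw [Units.val_inv_eq_inv_val]
    exact inv_eq_of_mul_eq_one_left h10
  rw [h.unit_spec, hd0, hd1, Units.val_mul, hinv, map_sub, map_one, map_mul, conjLocal_conjLocal_cm L v, mul_comm (d 1 : LocalRing L v)]

open scoped Classical in
/-- **VAN DIJK'S WEIGHT `Δ₂(t)`** on the diagonal torus `T₂` of `U(Φ₂)(L⁺_v)`: for `t` REGULAR in the sense «`d₀⁻¹d₁ − 1` is a unit» (`d i = torusEntry i t`) it is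
`δ_{B₂}^{1∕2}(t) · χ⁻(d₀⁻¹d₁ − 1)` — the modulus character of the Borel times the modulus of the σ-fixed scalar `d₀⁻¹d₁ − 1` on the SKEW line `Lie N₂ = {x : σx = −x}`
(★ `HeisRing.skewModulus`; `|det(Ad(t⁻¹) − 1)|_{𝔫₂}|`), i.e. the `N = 2` reading of the ★ `N = 3` term of record `vanDijkWeight` (whose Heisenberg-VECTOR factor
`χ_R(d₀⁻¹d₁ − 1)` has no counterpart here and whose centre index `2` becomes `1`) — and `0` otherwise (the non-regular part of `T₂` is `μ_T`-null).
[cite: Rogawski1990, §12.7 L. 12.7.2 (proof) p. 193; §4.9 (4.9.4) p. 56; §12.5 p. 182] [cite: vanDijk1972, Thm. p. 237] -/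
def vanDijkWeight₂ (t : ↥(cmBorelTriple L 2 v).M) : ℂ :=
  haveI := locallyCompactSpace_cmBorelU L 2 v
  if h : IsUnit ((((torusEntry (conjLocal L (IsCMField.complexConj L) v) (cmLocalForm L 2 v) 0 t)⁻¹ *
        torusEntry (conjLocal L (IsCMField.complexConj L) v) (cmLocalForm L 2 v) 1 t : (LocalRing L v)ˣ) : LocalRing L v) - 1) then
    ((rootDeltaChar (cmBorelTriple L 2 v).P
        ⟨(t : ↥(unitaryGroupOfForm (conjLocal L (IsCMField.complexConj L) v) (cmLocalForm L 2 v))), (cmBorelTriple L 2 v).M_le t.2⟩ : ℂˣ) : ℂ) *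
      (((letI : MeasurableSpace (LocalRing L v) := borel _; haveI : BorelSpace (LocalRing L v) := ⟨rfl⟩
        haveI : SecondCountableTopology (LocalRing L v) := secondCountableTopology_localRing (E := L) v
        ((HeisRing.skewModulus (conjLocal L (IsCMField.complexConj L) v) (continuous_conjLocal L (IsCMField.complexConj L) v) h.unit
            (map_unit_torusRatio_sub_one₂ L v t h))⁻¹ : ℝ≥0)) : ℝ) : ℂ)⁻¹
  else 0

open scoped Classical in
/-- Unfolding off the regular set: `Δ₂(t) = 0` when `d₀⁻¹d₁ − 1` is not a unit. [cite: Rogawski1990, §12.5 p. 182] -/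
theorem vanDijkWeight₂_of_not_isUnit (t : ↥(cmBorelTriple L 2 v).M)
    (h : ¬ IsUnit ((((torusEntry (conjLocal L (IsCMField.complexConj L) v) (cmLocalForm L 2 v) 0 t)⁻¹ *
      torusEntry (conjLocal L (IsCMField.complexConj L) v) (cmLocalForm L 2 v) 1 t : (LocalRing L v)ˣ) : LocalRing L v) - 1)) :
    vanDijkWeight₂ L v t = 0 := by
  rw [vanDijkWeight₂, dif_neg h]

/-! ## §4 The regular hyperbolic set `Ω₂` and the Weyl discriminant `dg₂` -/

/-- **THE REGULAR HYPERBOLIC SET `Ω₂ ⊆ U(Φ₂)(L⁺_v)`**: the conjugates of the regular elements of the diagonal torus `T₂` (the part of `G^r` meeting `T₂`).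
[cite: Rogawski1990, §12.5 p. 182; §12.7 L. 12.7.2 (proof) p. 193] -/
def hyperbolicSet₂ : Set ↥(unitaryGroupOfForm (conjLocal L (IsCMField.complexConj L) v) (cmLocalForm L 2 v)) :=
  {g | ∃ t : ↥(cmBorelTriple L 2 v).M,
      IsRegularElt ((((t : ↥(unitaryGroupOfForm (conjLocal L (IsCMField.complexConj L) v) (cmLocalForm L 2 v))) :
        ↥(unitaryGroupOfForm (conjLocal L (IsCMField.complexConj L) v) (cmLocalForm L 2 v))).val : GL (Fin 2) (LocalRing L v))) ∧
      IsConj (((t : ↥(unitaryGroupOfForm (conjLocal L (IsCMField.complexConj L) v) (cmLocalForm L 2 v))) :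
        ↥(unitaryGroupOfForm (conjLocal L (IsCMField.complexConj L) v) (cmLocalForm L 2 v)))) g}

/-- Unfolding of `Ω₂`. [cite: Rogawski1990, §12.5 p. 182] -/
theorem mem_hyperbolicSet₂_iff (g : ↥(unitaryGroupOfForm (conjLocal L (IsCMField.complexConj L) v) (cmLocalForm L 2 v))) :
    g ∈ hyperbolicSet₂ L v ↔ ∃ t : ↥(cmBorelTriple L 2 v).M,
      IsRegularElt ((((t : ↥(unitaryGroupOfForm (conjLocal L (IsCMField.complexConj L) v) (cmLocalForm L 2 v))) :
        ↥(unitaryGroupOfForm (conjLocal L (IsCMField.complexConj L) v) (cmLocalForm L 2 v))).val : GL (Fin 2) (LocalRing L v))) ∧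
      IsConj (((t : ↥(unitaryGroupOfForm (conjLocal L (IsCMField.complexConj L) v) (cmLocalForm L 2 v))) :
        ↥(unitaryGroupOfForm (conjLocal L (IsCMField.complexConj L) v) (cmLocalForm L 2 v)))) g := Iff.rfl

/-- **THE WEYL DISCRIMINANT `dg₂(g) = D_G(g)` OF `U(Φ₂)(L⁺_v)`** in closed form: `⁴√( N(discr(charpoly g)) · N(det g)⁻¹ )`, `N(x) = Π_{w∣v} |x_w|_w` — print's
`D_G(γ) = |Π_{α ∈ Φ}(1 − α(γ))|_{L⁺_v}^{1∕2}`: for the eigenvalues `λ₁, λ₂` of `γ`, `(1 − λ₁λ₂⁻¹)(1 − λ₂λ₁⁻¹) = −discr(charpoly γ) ∕ det γ` and `|·|_{L⁺_v}^{1∕2} = N(·)^{1∕4}` on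
`L⁺_v`-points (non-split `v`) — the `N = 2` reading of the ★ DG-FIELD closed form (`det`-exponent `N − 1`).  Off `G^r` the discriminant is a non-unit and `dg₂ = 0`.
[cite: Rogawski1990, §4.9 p. 54; §12.5 p. 182] [cite: HarishChandra1999AdmissibleDistributions, §17] -/
def dgFormula₂ (g : ↥(unitaryGroupOfForm (conjLocal L (IsCMField.complexConj L) v) (cmLocalForm L 2 v))) : ℝ :=
  ((NNReal.sqrt (NNReal.sqrt
    ((∏ w : PlacesOver L v, normAbs (w.1.adicCompletion L) (((g.val : GL (Fin 2) (UnitaryGroup.LocalRing L v)).val.charpoly.discr) w)) *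
      (∏ w : PlacesOver L v, normAbs (w.1.adicCompletion L) (((g.val : GL (Fin 2) (UnitaryGroup.LocalRing L v)).val.det) w))⁻¹)) : ℝ≥0) : ℝ)

/-- Unfolding of `dg₂`. [cite: Rogawski1990, §4.9 p. 54] -/
theorem dgFormula₂_def (g : ↥(unitaryGroupOfForm (conjLocal L (IsCMField.complexConj L) v) (cmLocalForm L 2 v))) :
    dgFormula₂ L v g = ((NNReal.sqrt (NNReal.sqrt
      ((∏ w : PlacesOver L v, normAbs (w.1.adicCompletion L) (((g.val : GL (Fin 2) (UnitaryGroup.LocalRing L v)).val.charpoly.discr) w)) *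
        (∏ w : PlacesOver L v, normAbs (w.1.adicCompletion L) (((g.val : GL (Fin 2) (UnitaryGroup.LocalRing L v)).val.det) w))⁻¹)) : ℝ≥0) : ℝ) := rfl

/-- `dg₂ ≥ 0`. [cite: Rogawski1990, §4.9 p. 54] -/
theorem dgFormula₂_nonneg (g : ↥(unitaryGroupOfForm (conjLocal L (IsCMField.complexConj L) v) (cmLocalForm L 2 v))) : 0 ≤ dgFormula₂ L v g :=
  NNReal.coe_nonneg _

end Summit.HodgeConjecture.HodgeConjecture.Cruxes.H413.K2E3QuasiSplitTwoTorusDefs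

end
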